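/-
Copyright (c) 2026. All rights reserved.
Released under Apache 2.0 license as described in the file LICENSE.
Authors: abc-iut cell, campaign-S prover seat abc-iut-S7.
-/
import Mathlib.Topology.Algebra.Module.ModuleTopology
import Mathlib.NumberTheory.Padics.ProperSpace
import Mathlib.MeasureTheory.Measure.Haar.DistribChar
import Mathlib.LinearAlgebra.Dimension.Free
import Literature.IUT.LogVolume.LogVolume
import Literature.NumberTheory.GaloisRepresentations.PadicResidueIndex
import HarnessLib

/-!
# Finite-dimensional `ℚ_p`-vector spaces with the module topology: local compactness, lattices,
# and the Haar modulus of scalars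

Classical background for the "log-volumes on tensor products of finite extensions of `ℚ_p`" of
[IUTchIV] Prop. 1.4 (i) (kurims p. 13: "by applying the fact that tensor products of finitely many
finite extensions of `ℚ_p` over `ℤ_p` decompose … we obtain a notion of log-volume … defined on
compact open subsets of such tensor products, valued in `ℝ`") and for Dupuy–Hilado's normalised
log Haar measures on `K_{v_0} ⊗_{ℚ_p} ⋯ ⊗_{ℚ_p} K_{v_j}` (§3.4/§3.6): a tensor product of fields has no
norm of its own, so we give every finite-dimensional `ℚ_p`-vector space `W` Mathlib's MODULE
TOPOLOGY (`IsModuleTopology ℚ_[p] W`, the finest topology making it a topological module = the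
product topology in any basis) and record, Mathlib-style and once:

* `basisContinuousAddEquiv b : W ≃ₜ+ (ι → ℚ_[p])` — coordinates in a basis are a topological
  isomorphism; hence `W` is Hausdorff, locally compact, second countable and a topological additive
  group (`t2Space`, `locallyCompactSpace`, `secondCountableTopology`, `isTopologicalAddGroup`);
* `basisLattice b` — the `ℤ_p`-lattice `{w | all coordinates in ℤ_p}` of a basis `b` is a COMPACT
  OPEN additive subgroup, i.e. an `IntegralStructure` (`basisIntegralStructure`, over
  `NormalizedHaar.lean`), so `W` carries the normalised Haar measures / log-volumes of
  `LogVolume.lean`;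
* `distribHaarChar_units_smul` — **the Haar modulus of a scalar `u ∈ ℚ_pˣ` acting on `W` is
  `mod_{ℚ_p}(u)^{dim W}`**, in particular `mod_W(p) = p^{−dim W}` (`distribHaarChar_p_smul`):
  Weil, *Basic Number Theory*, Ch. I §2 Cor. 2 of Thm. 3 (transported from the tree's
  `distribHaarChar_pi` / `distribHaarChar_padic` along the coordinate isomorphism).

[cite: WeilBNT1967, Ch. I §2, Cor. 2 of Th. 3] [cite: Mochizuki2012, IUTchIV Prop. 1.4 (i) p. 13]
Deliberately NOT here: tensor products themselves (`TensorPacketVolume.lean`), anything disputed.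
-/

noncomputable section

open MeasureTheory MeasureTheory.Measure Set Metric TopologicalSpace Topology
open scoped NNReal ENNReal Pointwise
open Literature.NumberTheory.GaloisRepresentations.Ultrametric
open Literature.NumberTheory.GaloisRepresentations.Ultrametric.PadicUniformizer

namespace Literature.IUT.LogVolume

namespace PadicModule

/-- Transport of the Haar modulus along an equivariant isomorphism of locally compact abelian groups:
if `e (g • a) = h • e a` then `mod_A(g) = mod_B(h)` (same statement and proof as the tree's
`Literature.NumberTheory.Automorphic.distribHaarChar_eq_of_continuousAddEquiv`, re-proved here to keep
this file's imports inside measure theory). [folklore] -/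
private theorem distribHaarChar_transport {G H A B : Type*} [Group G] [Group H]
    [AddCommGroup A] [DistribMulAction G A] [TopologicalSpace A] [IsTopologicalAddGroup A]
    [LocallyCompactSpace A] [ContinuousConstSMul G A]
    [AddCommGroup B] [DistribMulAction H B] [TopologicalSpace B] [IsTopologicalAddGroup B]
    [LocallyCompactSpace B] [ContinuousConstSMul H B]
    (e : A ≃ₜ+ B) (g : G) (h : H) (he : ∀ a, e (g • a) = h • e a) :
    distribHaarChar A g = distribHaarChar B h := by
  borelize A B
  set μ : Measure B := addHaar
  set ν : Measure A := μ.map e.symm with hν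
  haveI : ν.IsAddHaarMeasure := e.symm.isAddHaarMeasure_map μ
  haveI : ν.Regular := Regular.map e.symm.toHomeomorph
  have hνS : ∀ S : Set A, ν S = μ (e.symm ⁻¹' S) := fun S =>
    (e.symm.toHomeomorph.toMeasurableEquiv).map_apply S
  have he' : ∀ a, e (g⁻¹ • a) = h⁻¹ • e a := fun a => by
    rw [eq_inv_smul_iff, ← he, smul_inv_smul]
  obtain ⟨k⟩ := (inferInstance : Nonempty (TopologicalSpace.PositiveCompacts B))
  have hk0 : μ (k : Set B) ≠ 0 :=
    (Measure.measure_pos_of_nonempty_interior _ k.interior_nonempty).ne'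
  have hktop : μ (k : Set B) ≠ ∞ := k.isCompact.measure_lt_top.ne
  have h1 : e.symm ⁻¹' (e ⁻¹' (k : Set B)) = k := by
    ext b; simp only [Set.mem_preimage, ContinuousAddEquiv.apply_symm_apply]
  have h2 : e.symm ⁻¹' (g • (e ⁻¹' (k : Set B))) = h • (k : Set B) := by
    ext b
    simp only [Set.mem_preimage, Set.mem_smul_set_iff_inv_smul_mem, he',
      ContinuousAddEquiv.apply_symm_apply]
  refine distribHaarChar_eq_of_measure_smul_eq_mul (μ := ν) (s := e ⁻¹' (k : Set B))
    (by rw [hνS, h1]; exact hk0) (by rw [hνS, h1]; exact hktop) ?_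
  rw [hνS, hνS, h1, h2, distribHaarChar_mul]

variable (p : ℕ) [Fact p.Prime]
variable (W : Type*) [AddCommGroup W] [Module ℚ_[p] W]

include p

/-! ### The `ℤ_p`-lattice of a basis (no topology needed) -/

variable {W} in
/-- **The `ℤ_p`-lattice of a basis** `b`: the additive subgroup of vectors all of whose `b`-coordinates
lie in `ℤ_p = {‖·‖ ≤ 1}` (the "`O` free of rank `n` over `ℤ_p`" of Dupuy–Hilado §2.4.5 in coordinates).
[cite: WeilBNT1967, Ch. II §2, Th. 1] -/
def basisLattice {ι : Type*} [Fintype ι] (b : Module.Basis ι ℚ_[p] W) : AddSubgroup W :=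
  (AddSubgroup.pi Set.univ fun _ : ι => ((unitBall ℚ_[p] : OpenAddSubgroup ℚ_[p]) : AddSubgroup ℚ_[p])).comap
    b.equivFun.toLinearMap.toAddMonoidHom

variable {W} in
/-- Membership in the lattice of a basis: all coordinates have norm `≤ 1`.
[cite: WeilBNT1967, Ch. II §2, Th. 1] -/
theorem mem_basisLattice {ι : Type*} [Fintype ι] (b : Module.Basis ι ℚ_[p] W) {w : W} :
    w ∈ basisLattice p b ↔ ∀ i, ‖b.repr w i‖ ≤ 1 := by
  simp [basisLattice, AddSubgroup.mem_pi, mem_unitBall]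

variable {W} in
/-- The basis vectors lie in the lattice. [cite: WeilBNT1967, Ch. II §2, Th. 1] -/
theorem basis_mem_basisLattice {ι : Type*} [Fintype ι] [DecidableEq ι] (b : Module.Basis ι ℚ_[p] W)
    (i : ι) : b i ∈ basisLattice p b := by
  rw [mem_basisLattice]
  intro j
  rw [b.repr_self, Finsupp.single_apply]
  split_ifs <;> simp

variable {W} in
/-- The lattice of a basis is stable under scalars of norm `≤ 1` (it is a `ℤ_p`-module).
[cite: WeilBNT1967, Ch. II §2, Th. 1] -/
theorem smul_mem_basisLattice {ι : Type*} [Fintype ι] (b : Module.Basis ι ℚ_[p] W) {c : ℚ_[p]}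
    (hc : ‖c‖ ≤ 1) {w : W} (hw : w ∈ basisLattice p b) : c • w ∈ basisLattice p b := by
  rw [mem_basisLattice] at hw ⊢
  intro i
  rw [map_smul, Finsupp.smul_apply, smul_eq_mul, norm_mul]
  exact mul_le_one₀ hc (norm_nonneg _) (hw i)

variable [TopologicalSpace W] [IsModuleTopology ℚ_[p] W]

/-! ### Coordinates are a topological isomorphism -/

/-- **Coordinates in a basis**, `w ↦ (b.repr w i)_i`, as an isomorphism of topological additive groups
`W ≃ₜ+ (ι → ℚ_p)`: every linear map out of a module with the module topology is continuous, in both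
directions. [cite: WeilBNT1967, Ch. I §2, Cor. 2 of Th. 3] -/
def basisContinuousAddEquiv {ι : Type*} [Fintype ι] (b : Module.Basis ι ℚ_[p] W) :
    W ≃ₜ+ (ι → ℚ_[p]) :=
  haveI : ContinuousAdd W := IsModuleTopology.toContinuousAdd ℚ_[p] W
  { b.equivFun.toAddEquiv with
    continuous_toFun := IsModuleTopology.continuous_of_linearMap b.equivFun.toLinearMap
    continuous_invFun := IsModuleTopology.continuous_of_linearMap b.equivFun.symm.toLinearMap }

variable {W} in
/-- Unfolding `basisContinuousAddEquiv`. [cite: WeilBNT1967, Ch. I §2, Cor. 2 of Th. 3] -/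
@[simp] theorem basisContinuousAddEquiv_apply {ι : Type*} [Fintype ι] (b : Module.Basis ι ℚ_[p] W)
    (w : W) : basisContinuousAddEquiv p W b w = b.equivFun w := rfl

variable {W} in
/-- Unfolding the inverse of `basisContinuousAddEquiv`. [cite: WeilBNT1967, Ch. I §2, Cor. 2 of Th. 3] -/
@[simp] theorem basisContinuousAddEquiv_symm_apply {ι : Type*} [Fintype ι]
    (b : Module.Basis ι ℚ_[p] W) (x : ι → ℚ_[p]) :
    (basisContinuousAddEquiv p W b).symm x = b.equivFun.symm x := rfl

/-- `W` is a topological additive group. [cite: WeilBNT1967, Ch. I §2, Cor. 2 of Th. 3] -/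
theorem isTopologicalAddGroup : IsTopologicalAddGroup W :=
  IsModuleTopology.topologicalAddGroup ℚ_[p] W

/-! ### The lattice of a basis is a compact open subgroup -/

variable {W} in
/-- The lattice of a basis is the preimage of the unit box under the coordinate map.
[cite: WeilBNT1967, Ch. II §2, Th. 1] -/
theorem coe_basisLattice {ι : Type*} [Fintype ι] (b : Module.Basis ι ℚ_[p] W) :
    (basisLattice p b : Set W) =
      basisContinuousAddEquiv p W b ⁻¹' Set.pi Set.univ (fun _ : ι => closedBall (0 : ℚ_[p]) 1) := by
  ext w
  simp [mem_basisLattice, Set.mem_pi]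

variable {W} in
/-- The lattice of a basis is open. [cite: WeilBNT1967, Ch. II §2, Th. 1] -/
theorem isOpen_basisLattice {ι : Type*} [Fintype ι] (b : Module.Basis ι ℚ_[p] W) :
    IsOpen (basisLattice p b : Set W) := by
  rw [coe_basisLattice]
  exact (isOpen_set_pi Set.finite_univ fun _ _ => IsUltrametricDist.isOpen_closedBall _ one_ne_zero).preimage
    (basisContinuousAddEquiv p W b).continuous

variable {W} in
/-- The lattice of a basis is compact (`ℤ_p^ι` is). [cite: WeilBNT1967, Ch. II §2, Th. 1] -/
theorem isCompact_basisLattice {ι : Type*} [Fintype ι] (b : Module.Basis ι ℚ_[p] W) :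
    IsCompact (basisLattice p b : Set W) := by
  rw [coe_basisLattice]
  exact (basisContinuousAddEquiv p W b).toHomeomorph.isCompact_preimage.mpr
    (isCompact_univ_pi fun _ => isCompact_closedBall (0 : ℚ_[p]) 1)

variable {W} in
/-- **The lattice of a basis is an integral structure** (compact open subgroup) on `W`.
[cite: WeilBNT1967, Ch. II §2, Th. 1] -/
def basisIntegralStructure {ι : Type*} [Fintype ι] (b : Module.Basis ι ℚ_[p] W) : IntegralStructure W :=
  ⟨⟨basisLattice p b, isOpen_basisLattice p b⟩, isCompact_basisLattice p b⟩

variable {W} in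
/-- Unfolding `basisIntegralStructure`. [cite: WeilBNT1967, Ch. II §2, Th. 1] -/
@[simp] theorem coe_basisIntegralStructure {ι : Type*} [Fintype ι] (b : Module.Basis ι ℚ_[p] W) :
    (basisIntegralStructure p b : Set W) = basisLattice p b := rfl

variable {W} in
/-- **Sandwiched subgroups are integral structures**: an additive subgroup `H` of `W` containing the
lattice of one basis and contained in the lattice of another is compact open (open because it contains an
open subgroup; compact because open subgroups are closed) — e.g. `⊗ log_p(O^×_{k_i})` between
`p^{a}·⊗O_{k_i}` and `p^{−b}·⊗O_{k_i}` ([IUTchIV] Prop. 1.2 (ii)). [cite: WeilBNT1967, Ch. II §2, Th. 1] -/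
def sandwichIntegralStructure {ι ι' : Type*} [Fintype ι] [Fintype ι'] (b : Module.Basis ι ℚ_[p] W)
    (b' : Module.Basis ι' ℚ_[p] W) (H : AddSubgroup W) (hb : basisLattice p b ≤ H)
    (hb' : H ≤ basisLattice p b') : IntegralStructure W :=
  haveI := isTopologicalAddGroup p W
  letI HO : OpenAddSubgroup W :=
    ⟨H, AddSubgroup.isOpen_mono hb (isOpen_basisLattice p b)⟩
  ⟨HO, (isCompact_basisLattice p b').of_isClosed_subset HO.isClosed hb'⟩

variable {W} in
/-- Unfolding `sandwichIntegralStructure`. [cite: WeilBNT1967, Ch. II §2, Th. 1] -/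
@[simp] theorem coe_sandwichIntegralStructure {ι ι' : Type*} [Fintype ι] [Fintype ι']
    (b : Module.Basis ι ℚ_[p] W) (b' : Module.Basis ι' ℚ_[p] W) (H : AddSubgroup W)
    (hb : basisLattice p b ≤ H) (hb' : H ≤ basisLattice p b') :
    (sandwichIntegralStructure p b b' H hb hb' : Set W) = H := rfl

variable [FiniteDimensional ℚ_[p] W]

/-- `W` is Hausdorff. [cite: WeilBNT1967, Ch. I §2, Cor. 2 of Th. 3] -/
theorem t2Space : T2Space W :=
  (basisContinuousAddEquiv p W (Module.finBasis ℚ_[p] W)).toHomeomorph.symm.t2Space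

/-- `W` is locally compact (`ℚ_p` is). [cite: WeilBNT1967, Ch. I §2, Cor. 2 of Th. 3] -/
theorem locallyCompactSpace : LocallyCompactSpace W :=
  (basisContinuousAddEquiv p W (Module.finBasis ℚ_[p] W)).toHomeomorph.isClosedEmbedding.locallyCompactSpace

/-- `W` is second countable. [cite: WeilBNT1967, Ch. I §2, Cor. 2 of Th. 3] -/
theorem secondCountableTopology : SecondCountableTopology W :=
  (basisContinuousAddEquiv p W (Module.finBasis ℚ_[p] W)).toHomeomorph.isEmbedding.secondCountableTopology

/-! ### The Haar modulus of scalars -/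

/-- **The modulus of a scalar**: for `u ∈ ℚ_pˣ` acting on the finite-dimensional `ℚ_p`-vector space `W`,
`mod_W(u) = mod_{ℚ_p}(u)^{dim W}` (transport along coordinates, then the product formula on `ℚ_p^n`).
[cite: WeilBNT1967, Ch. I §2, Cor. 2 of Th. 3] -/
theorem distribHaarChar_units_smul (u : ℚ_[p]ˣ) :
    haveI := isTopologicalAddGroup p W
    haveI := locallyCompactSpace p W
    distribHaarChar W u = distribHaarChar ℚ_[p] u ^ Module.finrank ℚ_[p] W := by
  haveI := isTopologicalAddGroup p W
  haveI := locallyCompactSpace p W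
  let b := Module.finBasis ℚ_[p] W
  rw [distribHaarChar_transport (basisContinuousAddEquiv p W b) u u
    (fun w => by ext i; simp [Units.smul_def]), distribHaarChar_pi]

/-- **`mod_W(p) = p^{−dim W}`**: multiplication by `p` divides Haar measure on `W` by `p^{dim W}` — the
normalisation "`μ^log(p·R) = −log p`" of [IUTchIV] Prop. 1.4 (i) after dividing by the dimension.
[cite: WeilBNT1967, Ch. I §4, Th. 6] -/
theorem distribHaarChar_p_smul :
    haveI := isTopologicalAddGroup p W
    haveI := locallyCompactSpace p W
    distribHaarChar W (varpi p) = ((p : ℝ≥0)⁻¹) ^ Module.finrank ℚ_[p] W := by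
  rw [distribHaarChar_units_smul, distribHaarChar_padic]

end PadicModule

end Literature.IUT.LogVolume

end
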